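import Mathlib
import Summits.ResolutionOfSingularities.ResolutionOfSingularities.Theorems.HomologicalConductorPersistenceSurfacePlateauCertificate
import Summits.ResolutionOfSingularities.ResolutionOfSingularities.Theorems.HomologicalConductorPersistenceFrobeniusOrderSyzygy
import HarnessLib

/-!
# Rung S-2 `PersistenceSurface` (stmt-ResolutionOfSingularities-19970) — the plateau certificate AT ALL LEVELS:
# `z^a ∉ caˢ(A_n)` for every `s` when `a < ⌈n/2⌉`

Route `ResolutionOfSingularities/HomologicalConductor` (cell decomp-res, hand leafhand-res-homologicalconduct-23 g0).
OURS: AI-written, weaker than expert review; nothing here is a statement of the manuscript under review (Hironaka 2017);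
no crux, kill test or summit statement is proved.  SUPPORT level, def-free, fact-free.

`…PersistenceSurfacePlateauCertificate` (p837274) proves that `z^a` does not STABLY annihilate the matrix-factorisation
module `M_j = coker φ_j`, `φ_j = !![u, z^j; z^{n+1−j}, w]`, over the `A_n` ring `Λ_n = k[u,w,z]/(uw − z^{n+1})` when
`a < min(j, n+1−j)`.  To reach the Iyengar–Takahashi cohomology annihilator `caˢ(Λ_n)` one needs `M_j` to be an
ARBITRARILY HIGH syzygy (the tree's infinite-syzygy device
`FrobeniusOrderSyzygy.not_mem_cohomologyAnnihilatorOfDegree_of_forall_isSyzygy`).  This file supplies that by the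
2-periodicity of matrix factorisations, proved from scratch in the generality it needs:

* `range_eq_ker_of_matrixFactorization` — over a domain `S`, for square matrices with `φ ψ = ψ φ = f·1`, `f ≠ 0`:
  `range φ̄ = ker ψ̄` over `S/(f)` (lift, multiply by `φ`, cancel `f`);
* `isSyzygy_one_coker_of_matrixFactorization` — hence `coker φ̄` is a first syzygy of `coker ψ̄`
  (`0 → coker φ̄ —ψ̄→ (S/(f))^m → coker ψ̄ → 0`);
* `forall_isSyzygy_coker_of_matrixFactorization` — so `coker φ̄` is an `s`-th syzygy of a finitely generated module for
  every `s` (alternate `φ`, `ψ`);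
* **`An_pow_not_mem_cohomologyAnnihilatorOfDegree`** / **`An_pow_not_mem_cohomologyAnnihilator`** — over a field `k` of
  any characteristic: `z^a ∉ caˢ(Λ_n)` for every `s`, and `z^a ∉ ca(Λ_n)`, whenever `a < (n+1)/2 = ⌈n/2⌉`
  (take `j = (n+1)/2` in the certificate).  This is the sharp exponent: `z^{⌈n/2⌉}` stably annihilates every `M_j`
  (`stablyAnnihilates_An_syzygy`), in accordance with `ca(A_n) = (u, w, z^{⌈n/2⌉})`.

What is NOT here: the passage to the LOCAL ring of the `A_n` point (flat base change of the syzygy chain + units of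
`k[X]/(X^{n+1})`, the K-C3 pattern `…FrobeniusOrderLocal`) and the dictionary identifying a tower stage `T_1` with it.

References: D. Eisenbud, Trans. AMS 260 (1980) (matrix factorisations; periodicity) — mechanism only, proved here
directly; S. B. Iyengar, R. Takahashi, IMRN 2016, §2 and Lemma 2.14 [`IyengarTakahashi2014`].
-/

noncomputable section

-- single-problem summit: the doubled namespace component `ResolutionOfSingularities` is forced
set_option linter.dupNamespace false

open CategoryTheory Literature.RingTheory.CohomologyAnnihilator
open scoped Matrix
open Summit.ResolutionOfSingularities.ResolutionOfSingularities.Theorems.NoZeno.SandwichCluster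
open Summit.ResolutionOfSingularities.ResolutionOfSingularities.Theorems.HomologicalConductor.FrobeniusOrderSyzygy

universe u

namespace Summit.ResolutionOfSingularities.ResolutionOfSingularities.Theorems.HomologicalConductor.PersistenceSurfacePlateauCertificate

/-! ## Matrix factorisations: exactness and periodicity over `S/(f)` -/

section MF

variable {S : Type u} [CommRing S] [IsDomain S] {m : Type} [Fintype m] [DecidableEq m]

/-- **Exactness of a matrix factorisation.**  `S` a domain, `f ≠ 0`, `φ ψ = f·1` and `ψ φ = f·1` for square matrices
`φ, ψ` over `S`; with bars denoting reduction modulo `f`: `range φ̄ = ker ψ̄` on `(S/(f))^m`.  (`⊆`: `ψ̄ φ̄ = \bar f = 0`.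
`⊇`: lift `v` to `ṽ`, write `ψ ṽ = f y`, then `f ṽ = φ ψ ṽ = f φ y`, cancel `f`.) [folklore; cite: IyengarTakahashi2014, §2] -/
theorem range_eq_ker_of_matrixFactorization (f : S) (hf : f ≠ 0) (φ ψ : Matrix m m S)
    (h1 : φ * ψ = f • (1 : Matrix m m S)) (h2 : ψ * φ = f • (1 : Matrix m m S))
    (φq ψq : Matrix m m (S ⧸ Ideal.span {f})) (hφ : φq = φ.map (Ideal.Quotient.mk (Ideal.span {f})))
    (hψ : ψq = ψ.map (Ideal.Quotient.mk (Ideal.span {f}))) :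
    LinearMap.range φq.mulVecLin = LinearMap.ker ψq.mulVecLin := by
  subst hφ hψ
  set π := Ideal.Quotient.mk (Ideal.span {f}) with hπ
  have hπf : π f = 0 := by
    rw [hπ, Ideal.Quotient.eq_zero_iff_mem]; exact Ideal.mem_span_singleton_self f
  have hzero : (ψ.map π) * (φ.map π) = 0 := by
    rw [← Matrix.map_mul, h2]
    ext i l
    by_cases hil : i = l <;> simp [Matrix.smul_apply, hil, hπf]
  apply le_antisymm
  · rintro _ ⟨y, rfl⟩
    rw [LinearMap.mem_ker, Matrix.mulVecLin_apply, Matrix.mulVecLin_apply, Matrix.mulVec_mulVec, hzero,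
      Matrix.zero_mulVec]
  · intro v hv
    rw [LinearMap.mem_ker, Matrix.mulVecLin_apply] at hv
    have hsurj := fun i => Ideal.Quotient.mk_surjective (I := Ideal.span {f}) (v i)
    choose vS hvS using hsurj
    have hvS' : (π ∘ vS) = v := funext hvS
    -- `ψ ṽ ∈ (f)` componentwise
    have hcomp : ∀ i, π ((ψ *ᵥ vS) i) = 0 := by
      intro i
      rw [RingHom.map_mulVec, hvS']
      exact congrFun hv i
    have hy := fun i => Ideal.mem_span_singleton'.mp ((Ideal.Quotient.eq_zero_iff_mem).mp (hcomp i))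
    choose y hy using hy
    have hψv : ψ *ᵥ vS = f • y := by
      funext i; rw [← hy i, Pi.smul_apply, smul_eq_mul, mul_comm]
    -- `f ṽ = φ ψ ṽ = f φ y`
    have key : f • vS = f • (φ *ᵥ y) := by
      calc f • vS = (φ * ψ) *ᵥ vS := by rw [h1, Matrix.smul_mulVec, Matrix.one_mulVec]
        _ = φ *ᵥ (ψ *ᵥ vS) := by rw [Matrix.mulVec_mulVec]
        _ = f • (φ *ᵥ y) := by rw [hψv, Matrix.mulVec_smul]
    have hvSy : vS = φ *ᵥ y := by
      funext i
      have := congrFun key i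
      simp only [Pi.smul_apply, smul_eq_mul] at this
      exact mul_left_cancel₀ hf this
    refine ⟨π ∘ y, ?_⟩
    rw [Matrix.mulVecLin_apply, ← hvS', hvSy]
    funext i
    exact (RingHom.map_mulVec π φ y i).symm

/-- **`coker φ̄` is a first syzygy of `coker ψ̄`**: the short exact sequence
`0 → (S/(f))^m / range φ̄ —ψ̄→ (S/(f))^m → (S/(f))^m / range ψ̄ → 0` (middle term finitely generated free).
[folklore; cite: IyengarTakahashi2014, §2] -/
theorem isSyzygy_one_coker_of_matrixFactorization (f : S) (hf : f ≠ 0) (φ ψ : Matrix m m S)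
    (h1 : φ * ψ = f • (1 : Matrix m m S)) (h2 : ψ * φ = f • (1 : Matrix m m S))
    (φq ψq : Matrix m m (S ⧸ Ideal.span {f})) (hφ : φq = φ.map (Ideal.Quotient.mk (Ideal.span {f})))
    (hψ : ψq = ψ.map (Ideal.Quotient.mk (Ideal.span {f}))) :
    IsSyzygy 1 (ModuleCat.of (S ⧸ Ideal.span {f}) ((m → S ⧸ Ideal.span {f}) ⧸ LinearMap.range ψq.mulVecLin))
      (ModuleCat.of (S ⧸ Ideal.span {f}) ((m → S ⧸ Ideal.span {f}) ⧸ LinearMap.range φq.mulVecLin)) := by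
  have hrk := range_eq_ker_of_matrixFactorization f hf φ ψ h1 h2 φq ψq hφ hψ
  have hle : LinearMap.range φq.mulVecLin ≤ LinearMap.ker ψq.mulVecLin := hrk.le
  rw [isSyzygy_one_iff]
  haveI : Module.Finite (S ⧸ Ideal.span {f}) (ModuleCat.of (S ⧸ Ideal.span {f}) (m → S ⧸ Ideal.span {f})) :=
    Module.Finite.pi
  refine ⟨ModuleCat.of (S ⧸ Ideal.span {f}) (m → S ⧸ Ideal.span {f}), inferInstance,
    ModuleCat.projective_of_free (Pi.basisFun (S ⧸ Ideal.span {f}) m),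
    ModuleCat.ofHom ((LinearMap.range φq.mulVecLin).liftQ ψq.mulVecLin hle),
    ModuleCat.ofHom (LinearMap.range ψq.mulVecLin).mkQ, ?_, ?_⟩
  · rw [← ModuleCat.ofHom_comp]
    have : (LinearMap.range ψq.mulVecLin).mkQ ∘ₗ (LinearMap.range φq.mulVecLin).liftQ ψq.mulVecLin hle = 0 := by
      apply Submodule.linearMap_qext
      apply LinearMap.ext
      intro v
      rw [LinearMap.comp_assoc, Submodule.liftQ_mkQ, LinearMap.zero_comp, LinearMap.zero_apply,
        LinearMap.comp_apply, Submodule.mkQ_apply, Submodule.Quotient.mk_eq_zero]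
      exact LinearMap.mem_range_self _ v
    rw [this]; rfl
  · have hex : Function.Exact ((LinearMap.range φq.mulVecLin).liftQ ψq.mulVecLin hle)
        (LinearMap.range ψq.mulVecLin).mkQ := by
      intro p
      rw [Submodule.mkQ_apply, Submodule.Quotient.mk_eq_zero]
      constructor
      · rintro ⟨v, rfl⟩
        exact ⟨Submodule.Quotient.mk v, by rw [Submodule.liftQ_apply]⟩
      · rintro ⟨q, rfl⟩
        induction q using Submodule.Quotient.induction_on with
        | H v => rw [Submodule.liftQ_apply]; exact LinearMap.mem_range_self _ v
    have hinj : Function.Injective ((LinearMap.range φq.mulVecLin).liftQ ψq.mulVecLin hle) := by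
      rw [← LinearMap.ker_eq_bot]
      exact Submodule.ker_liftQ_eq_bot _ _ _ hrk.ge
    exact ModuleCat.shortComplex_shortExact _ hex hinj (Submodule.mkQ_surjective _)

/-- **Periodicity: `coker φ̄` is an `s`-th syzygy of a finitely generated module for EVERY `s`** (of `coker φ̄` for
even `s`, of `coker ψ̄` for odd `s`). [folklore; cite: IyengarTakahashi2014, §2] -/
theorem forall_isSyzygy_coker_of_matrixFactorization (f : S) (hf : f ≠ 0) :
    ∀ (s : ℕ) (φ ψ : Matrix m m S), φ * ψ = f • (1 : Matrix m m S) → ψ * φ = f • (1 : Matrix m m S) →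
    ∀ (φq ψq : Matrix m m (S ⧸ Ideal.span {f})), φq = φ.map (Ideal.Quotient.mk (Ideal.span {f})) →
    ψq = ψ.map (Ideal.Quotient.mk (Ideal.span {f})) →
    ∃ M : ModuleCat.{u} (S ⧸ Ideal.span {f}), Module.Finite (S ⧸ Ideal.span {f}) M ∧
      IsSyzygy s M (ModuleCat.of (S ⧸ Ideal.span {f}) ((m → S ⧸ Ideal.span {f}) ⧸ LinearMap.range φq.mulVecLin))
  | 0, φ, ψ, h1, h2, φq, ψq, hφ, hψ =>
    ⟨ModuleCat.of (S ⧸ Ideal.span {f}) ((m → S ⧸ Ideal.span {f}) ⧸ LinearMap.range φq.mulVecLin),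
      inferInstance, ⟨Iso.refl _⟩⟩
  | s + 1, φ, ψ, h1, h2, φq, ψq, hφ, hψ => by
    obtain ⟨M, hM, hs⟩ := forall_isSyzygy_coker_of_matrixFactorization f hf s ψ φ h2 h1 ψq φq hψ hφ
    have h1' := isSyzygy_one_coker_of_matrixFactorization f hf φ ψ h1 h2 φq ψq hφ hψ
    refine ⟨M, hM, ?_⟩
    have := hs.trans h1'
    rwa [Nat.add_comm] at this

end MF

/-! ## The `A_n` ring: `z^a ∉ caˢ(Λ_n)` for all `s`, `a < ⌈n/2⌉` -/

section ModelAn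

open MvPolynomial

variable (k : Type u) [Field k] (n : ℕ)

/-- The `A_n` coordinate ring `Λ_n = k[X₀,X₁,X₂]/(X₀X₁ − X₂^{n+1})` (local notation only). -/
local notation3 "Λ_[" k ", " n "]" =>
  MvPolynomial (Fin 3) k ⧸ Ideal.span {(X 0 * X 1 - X 2 ^ (n + 1) : MvPolynomial (Fin 3) k)}
/-- The quotient map `k[X₀,X₁,X₂] → Λ_n` (local notation only). -/
local notation3 "π_[" k ", " n "]" =>
  Ideal.Quotient.mk (Ideal.span {(X 0 * X 1 - X 2 ^ (n + 1) : MvPolynomial (Fin 3) k)})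

/-- The `A_n` equation is a non-zero polynomial (its `X₂^{n+1}`-coefficient is `−1`). [folklore] -/
theorem An_rel_ne_zero : (X 0 * X 1 - X 2 ^ (n + 1) : MvPolynomial (Fin 3) k) ≠ 0 := by
  intro h
  have hc := congrArg (MvPolynomial.coeff (Finsupp.single (2 : Fin 3) (n + 1))) h
  rw [MvPolynomial.coeff_sub, MvPolynomial.coeff_X_mul', MvPolynomial.coeff_X_pow, if_neg, if_pos rfl,
    MvPolynomial.coeff_zero] at hc
  · norm_num at hc
  · rw [Finsupp.mem_support_iff, Finsupp.single_apply, if_neg (by decide), not_not]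

/-- **`z^a ∉ caˢ(Λ_n)` for every level `s`, when `a < (n+1)/2 = ⌈n/2⌉`** (any field `k`, any characteristic):
`M_j = coker φ_j`, `j = (n+1)/2`, is an infinite syzygy (periodicity) not stably annihilated by `z^a` (the plateau
certificate), so the infinite-syzygy device applies. [this work; cite: IyengarTakahashi2014, Lemma 2.14] -/
theorem An_pow_not_mem_cohomologyAnnihilatorOfDegree (a : ℕ) (ha : a < (n + 1) / 2) (s : ℕ) :
    π_[k, n] (X 2) ^ a ∉ cohomologyAnnihilatorOfDegree Λ_[k, n] s := by
  set j := (n + 1) / 2 with hj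
  have haj : a < j := ha
  have hajn : a + j ≤ n := by omega
  have hjn : j ≤ n + 1 := by omega
  -- the matrix factorisation over `k[X₀,X₁,X₂]` and its reduction
  obtain ⟨h1, h2⟩ := An_isMatrixFactorization n (X 0 : MvPolynomial (Fin 3) k) (X 1) (X 2) j hjn
  have hφ : (!![π_[k, n] (X 0), π_[k, n] (X 2) ^ j; π_[k, n] (X 2) ^ (n + 1 - j), π_[k, n] (X 1)] :
      Matrix (Fin 2) (Fin 2) Λ_[k, n]) =
      (!![(X 0 : MvPolynomial (Fin 3) k), X 2 ^ j; X 2 ^ (n + 1 - j), X 1]).map π_[k, n] := by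
    ext i l; fin_cases i <;> fin_cases l <;> simp
  have hψ : (!![π_[k, n] (X 1), -π_[k, n] (X 2) ^ j; -π_[k, n] (X 2) ^ (n + 1 - j), π_[k, n] (X 0)] :
      Matrix (Fin 2) (Fin 2) Λ_[k, n]) =
      (!![(X 1 : MvPolynomial (Fin 3) k), -X 2 ^ j; -X 2 ^ (n + 1 - j), X 0]).map π_[k, n] := by
    ext i l; fin_cases i <;> fin_cases l <;> simp
  have hL := fun s => forall_isSyzygy_coker_of_matrixFactorization (m := Fin 2)
    (X 0 * X 1 - X 2 ^ (n + 1) : MvPolynomial (Fin 3) k) (An_rel_ne_zero k n) s _ _ h1 h2 _ _ hφ hψ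
  exact not_mem_cohomologyAnnihilatorOfDegree_of_forall_isSyzygy hL
    (not_stablyAnnihilates_An_syzygy k n a j haj hajn) s

/-- **`z^a ∉ ca(Λ_n)`** (`ca = ⋃ₛ caˢ`) when `a < (n+1)/2 = ⌈n/2⌉`, over any field. [this work;
cite: IyengarTakahashi2014, Lemma 2.14] -/
theorem An_pow_not_mem_cohomologyAnnihilator (a : ℕ) (ha : a < (n + 1) / 2) :
    π_[k, n] (X 2) ^ a ∉ cohomologyAnnihilator Λ_[k, n] := by
  rw [mem_cohomologyAnnihilator_iff]
  rintro ⟨s, hs⟩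
  exact An_pow_not_mem_cohomologyAnnihilatorOfDegree k n a ha s hs

end ModelAn

end Summit.ResolutionOfSingularities.ResolutionOfSingularities.Theorems.HomologicalConductor.PersistenceSurfacePlateauCertificate

end
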